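import Mathlib
import HarnessLib
import Summits.MatrixMultiplication.MatrixMultiplication.Theorems.OutsiderSandwichToricCeiling
import Summits.MatrixMultiplication.MatrixMultiplication.Theorems.OutsiderSandwichToricCeilingPowFibres

/-!
# OutsiderSandwich — the toric ceiling of `cw₂^{⊠N}` for EVERY `N ≥ 2`: no combinatorial
degeneration onto `⟨3^N - 1⟩` in any product basis (part 2: the theorem)
(decomp-mm lens 4, gen 43, kernel K43-4b; THESES-FREE, `ω`-free; helper toward `LaserTangency`,
stmt-32268 — the extremal subrank/packing cells of the literal host `kroneckerPow (cwTensor ℂ 2) N`)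

WHAT.  Fix `N` and a PRODUCT PATTERN `κ : Fin N → Bool` (coordinate `i` of `cw₂^{⊠N}` written in
the Coppersmith–Winograd basis if `κ i = true`, in the permutation basis `D a b c = [a, b, c pairwise
distinct]` if `κ i = false`; `D ≅ cw₂` over `ℂ`).  The support of the host in that basis is the
product frame `frame κ ⊆ (Word N)³` of part 1.  A leg-injective `Ψ ⊆ frame κ` with weights
`a b c : Word N → R` vanishing on `Ψ` and `≥ 1` on `frame κ ∖ Ψ` is a COMBINATORIAL DEGENERATION
(Strassen 1987; Bürgisser–Clausen–Shokrollahi, Algebraic Complexity Theory, Def. 15.29 /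
Lemma 15.31) of the host onto `⟨#Ψ⟩` — the currency of every laser-method and of the tree's
certificates `⟨7⟩ ⊴ cw₂^{⊠2}` (K42-e), `⟨20⟩, ⟨21⟩ ⊴ cw₂^{⊠3}` (K42-g/h).

* `productFrame_no_diagonal_comb_degeneration` (`2 ≤ N`, any `κ`, weights in any linearly ordered
  commutative ring): `#Ψ ≤ 3^N - 2`.  At `N = 2` this is K43-1/K43-3 (`≤ 7`, sharp in the cw
  basis); `productFrame_three_no_diagonal_comb_degeneration_twentySix` is the `N = 3` instance
  (`≤ 25`; the tree has `21` by such a certificate and `⟨27⟩ ⋬` outright, K42-f).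

THE ARGUMENT (uniform in `N`).  (1) `#Ψ ≤ 3^N` by leg-injectivity.  (2) `#Ψ = 3^N`: every leg
fibre of `frame κ` has `2^N` triples (part 1, `fibre_frame`), so `Σ_frame (a+b+c) = 2^N·Σ_Ψ = 0`
against `≥ #(frame ∖ Ψ) > 0` (`farkas`).  (3) `#Ψ = 3^N - 1`, missing words `x, y, z`: counting
the value `α` at coordinate `i` over `Ψ` (`count_identity`: `Σ_Ψ cntᵢ(α) + [xᵢ=α] + [yᵢ=α] +
[zᵢ=α] = 3^N`; a permutation coordinate has `cntᵢ(α) = 1`, a cw coordinate `cntᵢ(0) = 1` and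
`cntᵢ(1), cntᵢ(2)` even) PINS the missing triple to a STAR: `(xᵢ, yᵢ, zᵢ)` pairwise distinct for
every `i` (`star_dslot`).  (4) The parity certificate `cert κ (x, y, z)` of part 1 avoids the star
words and covers every other word exactly `2^(N-1)` times (`fibre_cert`), so `Σ_cert (a+b+c) =
2^(N-1)·Σ_Ψ = 0` against `≥ #cert - #Ψ = (3^N - 1)(2^(N-1) - 1) > 0` for `N ≥ 2`.  (At `N = 1`
step (4) is empty and indeed `⟨2⟩ ≤ cw₂`.)

HONEST SCOPE.  Toric (monomial / combinatorial-degeneration) certificates only: for arbitrary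
degenerations the tree knows `Q̲(cw₂^{⊠N}) ≤ 3^N - 1` (K42-f, polystability), and `⟨8⟩ ⊴ cw₂^{⊠2}`
by a non-monomial degeneration stays open.  Part 3 (`…ToricCeilingPowMonomial`) restates the
theorem on the hypotheses of `isApproxRestriction_of_monomial` for `kroneckerPow (cwTensor F 2) N`.
-/

set_option linter.dupNamespace false

namespace Summit.MatrixMultiplication.MatrixMultiplication.Theorems.OutsiderSandwichToricCeilingPow

open Finset
open Summit.MatrixMultiplication.MatrixMultiplication.Theorems.OutsiderSandwichToricCeiling
  (cwSlot dSlot dslot_of_counts)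
open Summit.MatrixMultiplication.MatrixMultiplication.Theorems.OutsiderSandwichToricCeilingPowFibres

variable {N : ℕ}

/-! ## §1 Double counting along a leg and the Farkas step -/

section Farkas

variable {R : Type*} [CommRing R]

/-- DOUBLE COUNTING along a leg `g`: if the `g`-fibres of `H` have size `m` over the `g`-image of
the leg-injective `Ψ` and `0` elsewhere, then `Σ_{t ∈ H} f (g t) = m · Σ_{t ∈ Ψ} f (g t)`. [folklore] -/
theorem sum_leg_eq_mul (H Ψ : Finset (Tr3 N)) (g : Tr3 N → Word N) (f : Word N → R) (m : ℕ)
    (hg : Set.InjOn g Ψ) (hH : ∀ p, #{t ∈ H | g t = p} = if p ∈ Ψ.image g then m else 0) :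
    ∑ t ∈ H, f (g t) = m * ∑ t ∈ Ψ, f (g t) := by
  rw [← Finset.sum_fiberwise' H g f, ← Finset.sum_image hg, Finset.mul_sum,
    ← Finset.sum_filter_add_sum_filter_not univ (fun p => p ∈ Ψ.image g)]
  simp only [Finset.sum_const, nsmul_eq_mul, Finset.filter_mem_eq_inter, Finset.univ_inter]
  rw [Finset.sum_eq_zero (s := univ.filter fun p => p ∉ Ψ.image g) fun p hp => by
    rw [hH p, if_neg (Finset.mem_filter.mp hp).2]; simp, add_zero]
  exact Finset.sum_congr rfl fun p hp => by rw [hH p, if_pos hp]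

/-- Counting a coordinate condition over a leg image. [folklore] -/
theorem sum_ite_eq_card_image {Ψ : Finset (Tr3 N)} {g : Tr3 N → Word N} (hg : Set.InjOn g Ψ)
    (P : Word N → Prop) [DecidablePred P] :
    ∑ t ∈ Ψ, (if P (g t) then 1 else 0) = #{p ∈ Ψ.image g | P p} := by
  rw [Finset.card_filter, Finset.sum_image hg]

/-- THE FARKAS STEP.  If `H ⊆ Φ` has more triples than the leg-injective `Ψ` and, on every leg,
covers the words used by `Ψ` exactly `m` times and the others not at all, then no weights make `Ψ`
a combinatorial degeneration of `Φ`: `Σ_H (a+b+c) = m·Σ_Ψ (a+b+c) = 0 < #(H ∖ Ψ) ≤ Σ_H`. [new] -/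
theorem farkas [LinearOrder R] [IsStrictOrderedRing R] {Φ Ψ H : Finset (Tr3 N)}
    {a b c : Word N → R} (m : ℕ) (hzero : ∀ t ∈ Ψ, a t.1 + b t.2.1 + c t.2.2 = 0)
    (hone : ∀ t ∈ Φ, t ∉ Ψ → 1 ≤ a t.1 + b t.2.1 + c t.2.2)
    (j₁ : Set.InjOn (fun t : Tr3 N => t.1) Ψ) (j₂ : Set.InjOn (fun t : Tr3 N => t.2.1) Ψ)
    (j₃ : Set.InjOn (fun t : Tr3 N => t.2.2) Ψ) (hHΦ : H ⊆ Φ) (hcard : #Ψ < #H)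
    (h₁ : ∀ p, #{t ∈ H | t.1 = p} = if p ∈ Ψ.image (fun t : Tr3 N => t.1) then m else 0)
    (h₂ : ∀ p, #{t ∈ H | t.2.1 = p} = if p ∈ Ψ.image (fun t : Tr3 N => t.2.1) then m else 0)
    (h₃ : ∀ p, #{t ∈ H | t.2.2 = p} = if p ∈ Ψ.image (fun t : Tr3 N => t.2.2) then m else 0) :
    False := by
  have hH : ∑ t ∈ H, (a t.1 + b t.2.1 + c t.2.2) = m * ∑ t ∈ Ψ, (a t.1 + b t.2.1 + c t.2.2) := by
    simp only [Finset.sum_add_distrib, mul_add]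
    rw [sum_leg_eq_mul H Ψ (fun t => t.1) a m j₁ h₁, sum_leg_eq_mul H Ψ (fun t => t.2.1) b m j₂ h₂,
      sum_leg_eq_mul H Ψ (fun t => t.2.2) c m j₃ h₃]
  rw [Finset.sum_eq_zero hzero, mul_zero, ← Finset.sum_filter_add_sum_filter_not H (· ∈ Ψ),
    Finset.sum_eq_zero (fun t ht => hzero t (Finset.mem_filter.mp ht).2), zero_add] at hH
  have hout : (#{t ∈ H | t ∉ Ψ} : R) * 1 ≤ ∑ t ∈ H with t ∉ Ψ, (a t.1 + b t.2.1 + c t.2.2) := by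
    rw [← nsmul_eq_mul]
    exact Finset.card_nsmul_le_sum _ _ _ fun t ht =>
      hone t (hHΦ (Finset.mem_filter.mp ht).1) (Finset.mem_filter.mp ht).2
  have hcnt : #{t ∈ H | t ∈ Ψ} + #{t ∈ H | t ∉ Ψ} = #H := Finset.card_filter_add_card_filter_not _
  have hle : #{t ∈ H | t ∈ Ψ} ≤ #Ψ := Finset.card_le_card fun t ht => (Finset.mem_filter.mp ht).2
  have hposR : (0 : R) < (#{t ∈ H | t ∉ Ψ} : R) * 1 := by
    rw [mul_one]; exact_mod_cast (show 0 < #{t ∈ H | t ∉ Ψ} by omega)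
  exact absurd (lt_of_lt_of_le hposR (hH ▸ hout)) (lt_irrefl 0)

end Farkas

/-! ## §2 Pinning the missing triple to a star -/

/-- The words with a prescribed letter at coordinate `i`: `3^(N-1)` of them. [folklore] -/
theorem card_coord_fibre (i : Fin N) (α : Fin 3) :
    #{p ∈ (univ : Finset (Word N)) | p i = α} = 3 ^ (N - 1) := by
  have h := Fintype.card_filter_piFinset_eq_of_mem (fun _ : Fin N => (univ : Finset (Fin 3))) i
    (a := α) (Finset.mem_univ _)
  rw [Fintype.piFinset_univ] at h
  rw [h, Finset.prod_const, Finset.card_univ, Fintype.card_fin, Finset.card_erase_of_mem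
    (Finset.mem_univ _), Finset.card_univ, Fintype.card_fin]

/-- Erasing a word lowers one coordinate fibre by one. [folklore] -/
theorem card_erase_coord_fibre (i : Fin N) (α : Fin 3) (x : Word N) :
    #{p ∈ univ.erase x | p i = α} + (if x i = α then 1 else 0) = 3 ^ (N - 1) := by
  rw [← card_coord_fibre i α, Finset.filter_erase]
  split_ifs with hx
  · exact Finset.card_erase_add_one (Finset.mem_filter.mpr ⟨Finset.mem_univ _, hx⟩)
  · rw [add_zero, Finset.erase_eq_of_notMem (s := univ.filter fun p : Word N => p i = α) (a := x)
      fun h => hx (Finset.mem_filter.mp h).2]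

/-- THE COUNTING STEP: for a diagonal missing exactly the words `x, y, z` on the three legs,
`Σ_{t ∈ Ψ} cntᵢ(α, t) + [xᵢ=α] + [yᵢ=α] + [zᵢ=α] = 3^N` for every coordinate `i` and value `α`.
[new] -/
theorem count_identity {Ψ : Finset (Tr3 N)} (j₁ : Set.InjOn (fun t : Tr3 N => t.1) Ψ)
    (j₂ : Set.InjOn (fun t : Tr3 N => t.2.1) Ψ) (j₃ : Set.InjOn (fun t : Tr3 N => t.2.2) Ψ)
    {x y z : Word N} (i₁ : Ψ.image (fun t : Tr3 N => t.1) = univ.erase x)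
    (i₂ : Ψ.image (fun t : Tr3 N => t.2.1) = univ.erase y)
    (i₃ : Ψ.image (fun t : Tr3 N => t.2.2) = univ.erase z) (i : Fin N) (α : Fin 3) :
    (∑ t ∈ Ψ, cnt i α t) + ((if x i = α then 1 else 0) + (if y i = α then 1 else 0) +
        (if z i = α then 1 else 0)) = 3 * 3 ^ (N - 1) := by
  have ex := card_erase_coord_fibre i α x
  have ey := card_erase_coord_fibre i α y
  have ez := card_erase_coord_fibre i α z
  simp only [cnt, Finset.sum_add_distrib]
  rw [sum_ite_eq_card_image j₁ (fun p => p i = α), sum_ite_eq_card_image j₂ (fun p => p i = α),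
    sum_ite_eq_card_image j₃ (fun p => p i = α), i₁, i₂, i₃]
  omega

/-- STAR PINNING: if a diagonal of the product frame misses exactly one word per leg, the three
missing words form a permutation triple in EVERY coordinate (value counts: in a permutation
coordinate each value is hit `#Ψ` times, in a cw coordinate `0` is hit `#Ψ` times and `1, 2` an even
number of times, against `3^N - [missing]`). [new] -/
theorem star_dslot (κ : Fin N → Bool) {Ψ : Finset (Tr3 N)} (hsub : Ψ ⊆ frame κ)
    (j₁ : Set.InjOn (fun t : Tr3 N => t.1) Ψ) (j₂ : Set.InjOn (fun t : Tr3 N => t.2.1) Ψ)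
    (j₃ : Set.InjOn (fun t : Tr3 N => t.2.2) Ψ) {x y z : Word N}
    (i₁ : Ψ.image (fun t : Tr3 N => t.1) = univ.erase x)
    (i₂ : Ψ.image (fun t : Tr3 N => t.2.1) = univ.erase y)
    (i₃ : Ψ.image (fun t : Tr3 N => t.2.2) = univ.erase z) (hcard : #Ψ + 1 = 3 ^ N)
    (hN : 1 ≤ N) (i : Fin N) : dSlot (x i) (y i) (z i) = true := by
  have total : 3 * 3 ^ (N - 1) = 3 ^ N := by
    rw [← pow_succ', Nat.sub_add_cancel hN]
  have CI := fun α => count_identity j₁ j₂ j₃ i₁ i₂ i₃ i α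
  have slot : ∀ t ∈ Ψ, slotB (κ i) (t.1 i) (t.2.1 i) (t.2.2 i) = true := fun t ht =>
    (Finset.mem_filter.mp (hsub ht)).2 i
  -- a value hit exactly once by every triple of `Ψ` is missing exactly once
  have once : ∀ α : Fin 3, (∀ t ∈ Ψ, cnt i α t = 1) →
      (if x i = α then 1 else 0) + (if y i = α then 1 else 0) + (if z i = α then 1 else 0) = 1 := by
    intro α h
    have hs : ∑ t ∈ Ψ, cnt i α t = #Ψ := by
      rw [Finset.sum_congr rfl h, Finset.sum_const, smul_eq_mul, mul_one]
    have := CI α; rw [hs, total] at this; omega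
  cases hκ : κ i
  · -- permutation coordinate: every value once
    exact dslot_of_counts_one _ _ _ fun α => once α fun t ht =>
      ((slot_cnt (κ i) _ _ _ (slot t ht) α).1 (Or.inr hκ))
  · -- cw coordinate: `0` once, `1` and `2` an odd number of times
    have zero := once 0 fun t ht => (slot_cnt (κ i) _ _ _ (slot t ht) 0).1 (Or.inl rfl)
    have odd : ∀ α : Fin 3, α ≠ 0 → Odd ((if x i = α then 1 else 0) + (if y i = α then 1 else 0) +
        (if z i = α then 1 else 0)) := by
      intro α hα
      have hev : Even (∑ t ∈ Ψ, cnt i α t) :=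
        Finset.even_sum _ fun t ht => (slot_cnt (κ i) _ _ _ (slot t ht) α).2 hκ hα
      have h3 : Odd (3 ^ N) := Odd.pow (by decide)
      have := CI α; rw [total] at this; rw [← this, Nat.odd_add] at h3
      exact Nat.not_even_iff_odd.mp fun hm => (Nat.not_even_iff_odd.mpr (h3.mpr hm)) hev
    exact dslot_of_counts _ _ _ zero (odd 1 (by decide)) (odd 2 (by decide))

/-! ## §3 The theorem -/

/-- **TORIC CEILING OF `cw₂^{⊠N}` (every `N ≥ 2`, every product basis).**  No diagonal `Ψ` of
the product frame `frame κ` with `#Ψ ≥ 3^N - 1` is a combinatorial degeneration: there are no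
weights `a, b, c : Word N → R` (any linearly ordered commutative ring) vanishing on `Ψ` and `≥ 1` on
`frame κ ∖ Ψ`.  Equivalently, every monomial / combinatorial-degeneration certificate of `⟨r⟩`
from `cw₂^{⊠N}` in a product basis has `r ≤ 3^N - 2`. [new] -/
theorem productFrame_no_diagonal_comb_degeneration {R : Type*} [CommRing R] [LinearOrder R]
    [IsStrictOrderedRing R] (hN : 2 ≤ N) (κ : Fin N → Bool) {Ψ : Finset (Tr3 N)}
    {a b c : Word N → R} (hsub : Ψ ⊆ frame κ) (hzero : ∀ t ∈ Ψ, a t.1 + b t.2.1 + c t.2.2 = 0)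
    (hone : ∀ t ∈ frame κ, t ∉ Ψ → 1 ≤ a t.1 + b t.2.1 + c t.2.2)
    (hdiag : ∀ t ∈ Ψ, ∀ t' ∈ Ψ, (t.1 = t'.1 ∨ t.2.1 = t'.2.1 ∨ t.2.2 = t'.2.2) → t = t')
    (hbig : 3 ^ N ≤ #Ψ + 1) : False := by
  have j₁ : Set.InjOn (fun t : Tr3 N => t.1) Ψ := fun t ht t' ht' e => hdiag t ht t' ht' (Or.inl e)
  have j₂ : Set.InjOn (fun t : Tr3 N => t.2.1) Ψ :=
    fun t ht t' ht' e => hdiag t ht t' ht' (Or.inr (Or.inl e))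
  have j₃ : Set.InjOn (fun t : Tr3 N => t.2.2) Ψ :=
    fun t ht t' ht' e => hdiag t ht t' ht' (Or.inr (Or.inr e))
  have hW : Fintype.card (Word N) = 3 ^ N := by simp
  have hle : #Ψ ≤ 3 ^ N := by
    rw [← Finset.card_image_of_injOn j₁, ← hW]; exact Finset.card_le_univ _
  have hN1 : 1 ≤ N := by omega
  have h9 : 9 ≤ 3 ^ N := by
    calc 9 = 3 ^ 2 := by norm_num
      _ ≤ 3 ^ N := Nat.pow_le_pow_right (by norm_num) hN
  rcases Nat.eq_or_lt_of_le hle with heq | hlt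
  · -- `#Ψ = 3^N`: the whole frame is the certificate, multiplicity `2^N`
    have im : ∀ g : Tr3 N → Word N, Set.InjOn g Ψ → Ψ.image g = univ := fun g hg =>
      Finset.eq_univ_of_card _ (by rw [Finset.card_image_of_injOn hg, heq, hW])
    refine farkas (2 ^ N) hzero hone j₁ j₂ j₃ (subset_refl (frame κ)) ?_ (fun p => ?_)
      (fun p => ?_) (fun p => ?_)
    · have hf : #(frame κ) = ∑ p : Word N, #{t ∈ frame κ | t.1 = p} :=
        Finset.card_eq_sum_card_fiberwise fun t _ => Finset.mem_univ _
      rw [Finset.sum_congr rfl fun p _ => (fibre_frame κ p).1, Finset.sum_const, Finset.card_univ,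
        hW, smul_eq_mul] at hf
      have h2 : 2 ≤ 2 ^ N := by
        calc 2 = 2 ^ 1 := by norm_num
          _ ≤ 2 ^ N := Nat.pow_le_pow_right (by norm_num) hN1
      rw [heq, hf]
      calc 3 ^ N < 3 ^ N * 2 := by omega
        _ ≤ 3 ^ N * 2 ^ N := Nat.mul_le_mul_left _ h2
    · rw [(fibre_frame κ p).1, im _ j₁]; simp
    · rw [(fibre_frame κ p).2.1, im _ j₂]; simp
    · rw [(fibre_frame κ p).2.2, im _ j₃]; simp
  · -- `#Ψ = 3^N - 1`: pin the star, use the parity certificate, multiplicity `2^(N-1)`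
    have hcard : #Ψ + 1 = 3 ^ N := by omega
    have ex : ∀ g : Tr3 N → Word N, Set.InjOn g Ψ → ∃ x : Word N, Ψ.image g = univ.erase x :=
      fun g hg => by
      have h1 : #(univ \ Ψ.image g) = 1 := by
        rw [Finset.card_univ_sdiff, Finset.card_image_of_injOn hg, hW]; omega
      obtain ⟨x, hx⟩ := Finset.card_eq_one.mp h1
      exact ⟨x, by rw [← Finset.sdiff_singleton_eq_erase, ← hx,
        Finset.sdiff_sdiff_eq_self (Finset.subset_univ _)]⟩
    obtain ⟨x, i₁⟩ := ex _ j₁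
    obtain ⟨y, i₂⟩ := ex _ j₂
    obtain ⟨z, i₃⟩ := ex _ j₃
    have hs : ∀ i, dSlot (x i) (y i) (z i) = true :=
      fun i => star_dslot κ hsub j₁ j₂ j₃ i₁ i₂ i₃ hcard hN1 i
    have fc := fun p => fibre_cert κ (s := (x, y, z)) hs p
    have hHΦ : cert κ (x, y, z) ⊆ frame κ := Finset.filter_subset _ _
    refine farkas (H := cert κ (x, y, z)) (2 ^ (N - 1)) hzero hone j₁ j₂ j₃ hHΦ ?_ (fun p => ?_)
      (fun p => ?_) (fun p => ?_)
    · have hf : #(cert κ (x, y, z)) = ∑ p : Word N, #{t ∈ cert κ (x, y, z) | t.1 = p} :=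
        Finset.card_eq_sum_card_fiberwise fun t _ => Finset.mem_univ _
      rw [Finset.sum_congr rfl fun p _ => (fc p).1, Finset.sum_ite, Finset.sum_const_zero, zero_add,
        Finset.sum_const, smul_eq_mul, Finset.filter_ne', Finset.card_erase_of_mem
        (Finset.mem_univ _), Finset.card_univ, hW] at hf
      have h2 : 2 ≤ 2 ^ (N - 1) := by
        calc 2 = 2 ^ 1 := by norm_num
          _ ≤ 2 ^ (N - 1) := Nat.pow_le_pow_right (by norm_num) (by omega)
      rw [hf]
      calc #Ψ < #Ψ * 2 := by omega
        _ ≤ (3 ^ N - 1) * 2 ^ (N - 1) := Nat.mul_le_mul (by omega) h2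
    · rw [(fc p).1, i₁]; by_cases hp : p = x <;> simp [hp]
    · rw [(fc p).2.1, i₂]; by_cases hp : p = y <;> simp [hp]
    · rw [(fc p).2.2, i₃]; by_cases hp : p = z <;> simp [hp]

/-- The `N = 3` instance: no combinatorial degeneration `⟨26⟩ ⊴ cw₂^{⊠3}` in any product basis
(the tree has `⟨21⟩ ⊴ cw₂^{⊠3}` by such a certificate, K42-h, and `⟨27⟩ ⋬` outright, K42-f). [new] -/
theorem productFrame_three_no_diagonal_comb_degeneration_twentySix {R : Type*} [CommRing R]
    [LinearOrder R] [IsStrictOrderedRing R] (κ : Fin 3 → Bool) {Ψ : Finset (Tr3 3)}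
    {a b c : Word 3 → R} (hsub : Ψ ⊆ frame κ) (hzero : ∀ t ∈ Ψ, a t.1 + b t.2.1 + c t.2.2 = 0)
    (hone : ∀ t ∈ frame κ, t ∉ Ψ → 1 ≤ a t.1 + b t.2.1 + c t.2.2)
    (hdiag : ∀ t ∈ Ψ, ∀ t' ∈ Ψ, (t.1 = t'.1 ∨ t.2.1 = t'.2.1 ∨ t.2.2 = t'.2.2) → t = t')
    (h26 : 26 ≤ #Ψ) : False :=
  productFrame_no_diagonal_comb_degeneration (by norm_num) κ hsub hzero hone hdiag (by omega)

end Summit.MatrixMultiplication.MatrixMultiplication.Theorems.OutsiderSandwichToricCeilingPow
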